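import Mathlib
import Literature.NumberTheory.Transcendental.BlochWignerDilogarithm
import Literature.NumberTheory.Transcendental.BlochWignerDilogSeriesProofs
import Literature.NumberTheory.Transcendental.CalegariDimitrovTangL2Chi3Clausen
import Literature.NumberTheory.LFunctions.DirichletLValueBernoulli
import HarnessLib

/-!
# `ZagierDilogarithmConjecture` (stmt-KontsevichZagierPeriods-10550) — line
`kummer-clausen-linearisation` (reshape c4, "the cyclotomic sector, exactly"), stub
`stub_clausenCharSumPrimitive`

**The Clausen character sum of a primitive odd character.** Let `ζ_N = exp(2πi/N)` (`N ≥ 1`),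
`D` the Bloch–Wigner dilogarithm (`blochWignerDilog`) and `χ` a PRIMITIVE ODD Dirichlet character
modulo `N`. Then
`Σ_{c mod N} χ(c) · D(ζ_N^c) = −i · W(χ) · L(2, χ⁻¹)`,
`W(χ) = Σ_a χ(a) e^{2πia/N} = gaussSum χ stdAddChar` the Gauss sum.

Proof (Fourier/character-sum algebra, three lemmas).
* `hasSum_blochWignerDilog_exp_pow` — on the unit circle `D` is Clausen's function:
  `D(ζ_N^k) = Σ_{n ≥ 1} sin(2πnk/N)/n²` (the tree's `Dilog.blochWignerDilog_exp_mul_I`,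
  `D(e^{iθ}) = Σ sin(nθ)/n²`, pushed through `ℝ → ℂ`; the `n = 0` term vanishes).
* `sum_char_mul_sin` — for every `n ∈ ℕ`: `Σ_c χ(c) sin(2πnc/N) = −i · W(χ) · χ⁻¹(n)`: write
  `sin z = (e^{−iz} − e^{iz}) i/2` and use Gauss inversion for the primitive character `χ`
  (`Σ_a χ(a) e^{2πima/N} = χ⁻¹(m) W(χ)` for EVERY integer `m`, the tree's
  `LFunctions.sum_inv_apply_mul_cexp` applied to `χ⁻¹`) at `m = n` and `m = −n`, together with
  `χ⁻¹(−n) = −χ⁻¹(n)` (`χ⁻¹` is odd).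
* the finite sum over `c` commutes with the series (`hasSum_sum`), and
  `Σ_{n ≥ 1} χ⁻¹(n)/n² = L(2, χ⁻¹)` (`DirichletCharacter.LFunction_eq_LSeries`).
Mathlib + the tree's dilogarithm files only; sorry-free; axioms ⊆ {propext, Classical.choice,
Quot.sound}.

## References

* T. M. Apostol, *Introduction to Analytic Number Theory*, UTM, Springer (1976), Thm. 8.15 (b)
  (separability of Gauss sums of primitive characters). [Apostol1976]
* D. Zagier, *The dilogarithm function*, Frontiers in Number Theory, Physics, and Geometry II,
  Springer (2007), Ch. I §3 (`D(e^{iθ}) = Cl₂(θ)`). [Zagier2007Dilogarithm]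
-/

noncomputable section

open scoped BigOperators ComplexConjugate
open Literature.NumberTheory.Transcendental

namespace Summit.KontsevichZagierPeriods.HyperbolicBloch.ZagierDilogarithmCyclotomic

/-! ### `D` on the unit circle, as a complex series -/

/-- The Clausen series `Σ sin(nθ)/n²` converges absolutely (`|sin| ≤ 1`, `Σ 1/n² < ∞`).
[folklore] -/
theorem summable_sin_div_sq (θ : ℝ) : Summable fun n : ℕ => Real.sin (n * θ) / (n : ℝ) ^ 2 := by
  refine Summable.of_norm_bounded (Real.summable_one_div_nat_pow.mpr one_lt_two) fun n => ?_
  rw [norm_div, norm_pow, Real.norm_natCast, Real.norm_eq_abs]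
  exact div_le_div_of_nonneg_right (Real.abs_sin_le_one _) (by positivity)

/-- `D(e^{iθ}) = Σ_{n ≥ 0} sin(nθ)/n²` as a convergent COMPLEX series (the `n = 0` term is `0`).
[cite: Zagier2007Dilogarithm, Ch. I §3] -/
theorem hasSum_blochWignerDilog_exp_mul_I (θ : ℝ) :
    HasSum (fun n : ℕ => Complex.sin (n * θ) / (n : ℂ) ^ 2)
      ((blochWignerDilog (Complex.exp (θ * Complex.I)) : ℂ)) := by
  have h : HasSum (fun n : ℕ => Real.sin (n * θ) / (n : ℝ) ^ 2)
      (blochWignerDilog (Complex.exp (θ * Complex.I))) := by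
    rw [Dilog.blochWignerDilog_exp_mul_I]
    exact (summable_sin_div_sq θ).hasSum
  refine (Complex.hasSum_ofReal.mpr h).congr_fun fun n => ?_
  push_cast
  rfl

/-- `ζ_N^k = e^{iθ}` with `θ = 2πk/N`. [folklore] -/
theorem cexp_two_pi_div_pow (N k : ℕ) :
    Complex.exp (2 * Real.pi * Complex.I / N) ^ k =
      Complex.exp ((2 * Real.pi * k / N : ℝ) * Complex.I) := by
  rw [← Complex.exp_nat_mul]
  congr 1
  push_cast
  ring

/-- **Clausen at roots of unity**: `D(ζ_N^k) = Σ_{n ≥ 0} sin(2πnk/N)/n²` (complex series, the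
`n = 0` term is `0`). [cite: Zagier2007Dilogarithm, Ch. I §3] -/
theorem hasSum_blochWignerDilog_exp_pow (N k : ℕ) :
    HasSum (fun n : ℕ => Complex.sin (2 * Real.pi * n * k / N) / (n : ℂ) ^ 2)
      ((blochWignerDilog (Complex.exp (2 * Real.pi * Complex.I / N) ^ k) : ℂ)) := by
  rw [cexp_two_pi_div_pow]
  refine (hasSum_blochWignerDilog_exp_mul_I _).congr_fun fun n => ?_
  rw [show (2 * Real.pi * n * k / N : ℂ) = n * ((2 * Real.pi * k / N : ℝ) : ℂ) by
    push_cast; ring]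

/-! ### The character sum against `sin` -/

variable {N : ℕ} [NeZero N]

/-- **Gauss inversion for a primitive `χ`**: `Σ_a χ(a) e^{2πima/N} = χ⁻¹(m) W(χ)` for every
`m ∈ ℤ` (the tree's `sum_inv_apply_mul_cexp` for the primitive character `χ⁻¹`).
[cite: Apostol1976, Thm. 8.15 (b)] -/
theorem sum_char_mul_cexp (χ : DirichletCharacter ℂ N) (hχ : χ.IsPrimitive) (m : ℤ) :
    ∑ a : ZMod N, χ a * Complex.exp (2 * Real.pi * Complex.I * m * a.val / N) =
      χ⁻¹ m * gaussSum χ (ZMod.stdAddChar (N := N)) := by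
  have h := Literature.NumberTheory.LFunctions.sum_inv_apply_mul_cexp χ⁻¹
    (Literature.NumberTheory.LFunctions.isPrimitive_inv χ hχ) m
  rwa [inv_inv] at h

omit [NeZero N] in
/-- The inverse of an odd character is odd. [folklore] -/
theorem inv_odd (χ : DirichletCharacter ℂ N) (hodd : χ.Odd) : χ⁻¹.Odd := by
  rw [DirichletCharacter.Odd] at hodd ⊢
  rw [MulChar.inv_apply_eq_inv', hodd, inv_neg, inv_one]

/-- **The odd character sum against `sin`**: for a primitive odd `χ` and `n ∈ ℕ`,
`Σ_c χ(c) sin(2πnc/N) = −i · W(χ) · χ⁻¹(n)` (`sin z = (e^{−iz} − e^{iz}) i/2`, Gauss inversion at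
`±n`, `χ⁻¹(−n) = −χ⁻¹(n)`). [cite: Apostol1976, Thm. 8.15 (b)] -/
theorem sum_char_mul_sin (χ : DirichletCharacter ℂ N) (hχ : χ.IsPrimitive) (hodd : χ.Odd)
    (n : ℕ) :
    ∑ c : ZMod N, χ c * Complex.sin (2 * Real.pi * n * c.val / N) =
      -(Complex.I * gaussSum χ (ZMod.stdAddChar (N := N)) * χ⁻¹ n) := by
  have hneg : χ⁻¹ ((-(n : ℤ) : ℤ) : ZMod N) = -χ⁻¹ n := by
    rw [Int.cast_neg, Int.cast_natCast]
    exact DirichletCharacter.Odd.eval_neg χ⁻¹ (n : ZMod N) (inv_odd χ hodd)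
  have ea : ∀ c : ZMod N, Complex.exp (-(2 * Real.pi * n * c.val / N : ℂ) * Complex.I) =
      Complex.exp (2 * Real.pi * Complex.I * ((-(n : ℤ) : ℤ) : ℂ) * c.val / N) := fun c => by
    congr 1
    push_cast
    ring
  have eb : ∀ c : ZMod N, Complex.exp ((2 * Real.pi * n * c.val / N : ℂ) * Complex.I) =
      Complex.exp (2 * Real.pi * Complex.I * ((n : ℤ) : ℂ) * c.val / N) := fun c => by
    congr 1
    push_cast
    ring
  calc ∑ c : ZMod N, χ c * Complex.sin (2 * Real.pi * n * c.val / N)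
      = (∑ c : ZMod N, χ c * Complex.exp (2 * Real.pi * Complex.I * ((-(n : ℤ) : ℤ) : ℂ) *
            c.val / N) -
          ∑ c : ZMod N, χ c * Complex.exp (2 * Real.pi * Complex.I * ((n : ℤ) : ℂ) *
            c.val / N)) * Complex.I / 2 := by
        rw [← Finset.sum_sub_distrib, Finset.sum_mul, Finset.sum_div]
        refine Finset.sum_congr rfl fun c _ => ?_
        rw [Complex.sin, ea, eb]
        ring
    _ = -(Complex.I * gaussSum χ (ZMod.stdAddChar (N := N)) * χ⁻¹ n) := by
        rw [sum_char_mul_cexp χ hχ, sum_char_mul_cexp χ hχ, hneg, Int.cast_natCast]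
        ring

/-! ### The stub -/

/-- **Stub `stub_clausenCharSumPrimitive` (the Clausen character sum of a primitive odd
character).** For a primitive odd Dirichlet character `χ mod N`:
`Σ_{c mod N} χ(c) D(ζ_N^c) = −i · W(χ) · L(2, χ⁻¹)`, `W(χ) = Σ_a χ(a) e^{2πia/N}` the Gauss sum
(Clausen series `D(e^{iθ}) = Σ sin(nθ)/n²`, Gauss inversion `Σ_a χ(a) e^{2πina/N} = χ⁻¹(n) W(χ)`
at `±n`, and `L(2, χ⁻¹) = Σ χ⁻¹(n)/n²`). [cite: Apostol1976, Thm. 8.15 (b)] -/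
theorem stub_clausenCharSumPrimitive :
    ∀ (N : ℕ) [NeZero N] (χ : DirichletCharacter ℂ N), χ.IsPrimitive → χ.Odd →
      (∑ c : ZMod N, χ c *
          (blochWignerDilog (Complex.exp (2 * Real.pi * Complex.I / N) ^ c.val) : ℂ)) =
        -(Complex.I * gaussSum χ (ZMod.stdAddChar (N := N)) * χ⁻¹.LFunction 2) := by
  intro N _ χ hχ hodd
  set W : ℂ := gaussSum χ (ZMod.stdAddChar (N := N)) with hW
  -- each `D(ζ^c)` as a series, weighted by `χ(c)` and summed over `c`
  have hF := hasSum_sum fun (c : ZMod N) (_ : c ∈ Finset.univ) =>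
    (hasSum_blochWignerDilog_exp_pow N c.val).mul_left (χ c)
  -- the `n`-th term is `-(I W) χ⁻¹(n) / n²`
  have hterm : ∀ n : ℕ, ∑ c ∈ (Finset.univ : Finset (ZMod N)),
      χ c * (Complex.sin (2 * Real.pi * n * (c.val : ℕ) / N) / (n : ℂ) ^ 2) =
        -(Complex.I * W) * (χ⁻¹ n / (n : ℂ) ^ 2) := by
    intro n
    calc ∑ c ∈ (Finset.univ : Finset (ZMod N)),
          χ c * (Complex.sin (2 * Real.pi * n * (c.val : ℕ) / N) / (n : ℂ) ^ 2)
        = (∑ c : ZMod N, χ c * Complex.sin (2 * Real.pi * n * c.val / N)) / (n : ℂ) ^ 2 := by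
          rw [Finset.sum_div]
          refine Finset.sum_congr rfl fun c _ => ?_
          ring
      _ = -(Complex.I * W) * (χ⁻¹ n / (n : ℂ) ^ 2) := by
          rw [sum_char_mul_sin χ hχ hodd n]
          ring
  simp_rw [hterm] at hF
  -- the `L`-series of `χ⁻¹` at `2`
  have hre : 1 < (2 : ℂ).re := by norm_num
  have hL : HasSum (fun n : ℕ => χ⁻¹ n / (n : ℂ) ^ 2) (χ⁻¹.LFunction 2) := by
    rw [DirichletCharacter.LFunction_eq_LSeries χ⁻¹ hre]
    refine ((DirichletCharacter.LSeriesSummable_of_one_lt_re χ⁻¹ hre).hasSum).congr_fun ?_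
    intro n
    rcases eq_or_ne n 0 with rfl | hn
    · simp
    · rw [LSeries.term_of_ne_zero hn, Complex.cpow_two]
  rw [hF.unique (hL.mul_left (-(Complex.I * W)))]
  ring

end Summit.KontsevichZagierPeriods.HyperbolicBloch.ZagierDilogarithmCyclotomic

end
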